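import Mathlib
import Literature.NumberTheory.Automorphic.TwistedQuotientConeDescentStep
import Literature.NumberTheory.Automorphic.ResGLnConeDictionaryCone
import Literature.NumberTheory.Automorphic.ResGLnCohomology
import Summits.Langlands.Langlands.Theorems.IrreducibilityBySelfDualityHeckeEigenvalueFieldStubStairGrowth
import HarnessLib

/-!
# The per-coset staircase has polynomial `C¹` growth on the whole cone — crux HeckeEigenvalueField
# (stmt-Langlands-13632), line Sketch, stub `stub_fam_stair_growth` (FAM-STAIR-GROWTH)

Namespace `Summit.Langlands.Langlands.Theorems.HeckeEigenvalueField.Res`.  Theorems only (no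
definition, no named fact, no `sorry`).

Setting: a level coset `cL ∈ GL_n(𝔸_K^∞) ⧸ K_f(𝔫)` and a subgroup `Γc ≤ GL_n(K)⁺` (the case of
interest being the arithmetic stabiliser `Stab(cL).comap diagPos`; the statement is uniform in `Γc`, which
keeps the registered header under the gate's 3900-character stub-signature cap) acting linearly on the
hermitian space `W = hermSpace n K` (`a_c γ : H ↦ γ H γᴴ` through the mixed embedding) and preserving the
open convex positive cone `X = posCone n K ∋ 1 = hermOne`; the cone form `ω_c = coneForm η cL.out` (a
`(q+1)`-form on `W` with values in `E_λ(ℂ)`), placed in degree `q + 1` of a total family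
(`TwistedQuotient.single`), and its STAIRCASE `stair j` (`Literature/…/TwistedQuotientConeDescent.lean`:
radial primitives centred at the last vertex, alternating face sums).  The tower `κ` of the statement
is `κ_j = stair j` for `j < q`, `κ_q = stair q` in positive form degree, and in form degree `0`
`κ_q(g) = stair q (g) - (the constant 0-form (-1)^{(q+1)(q+2)/2} b(g))`.

Statement: if `sz ≥ 1` is a cone gauge dominating the norm and polynomial along segments, and
`ω_c` is `C^∞` on the cone with `‖ω_c‖, ‖Dω_c‖ ≤ C sz^k` there, then every component `κ_j(g) c r`
(`j ≤ q`) satisfies `‖κ_j(g) c r‖, ‖D(κ_j(g) c r)‖ ≤ C' sz^{k'}` on the cone.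

Proof: the landed GROWTH-κ `stub_stair_growth` (`…StubStairGrowth.lean`) gives exactly this for every
`stair p g c r` (with `Γ = 𝒢 = Γc`, `L = ⊤`, `X = posCone`, `x₀ = 1`: the cone is open
`ResGLnCone.isOpen_posCone`, convex `convex_posCone`, stable `mapsTo_coneActionRat_posCone`, and
`hermOne_mem_posCone`); the correction of `κ_q` in degree `0` is a constant, which costs `‖const‖ sz^k`
on the norm (`sz ≥ 1`) and nothing on the derivative (`fderiv_sub_const`).

## References

* R. Bott, L. W. Tu, *Differential Forms in Algebraic Topology*, GTM 82 (1982), §I.4 (the homotopy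
  operator), §II.9 (the staircase). [BottTu1982Forms]
* A. Borel, *Regularization theorems in Lie algebra cohomology. Applications*, Duke Math. J. 50
  (1983), §3. [Borel1983Regularization]
-/

set_option linter.dupNamespace false -- project-wide: `Summit.Langlands.Langlands` is the mandated namespace

noncomputable section

open scoped Classical Matrix TensorProduct
open NumberField NumberField.mixedEmbedding Literature.NumberTheory.Automorphic
  Literature.NumberTheory.Automorphic.TwistedQuotient

namespace Summit.Langlands.Langlands.Theorems.HeckeEigenvalueField.Res

namespace FamStairGrowth

/-- **Subtracting a constant does not change polynomial `C¹` growth** (for a size function `sz ≥ 1`):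
if `h = f - v` pointwise and `‖f‖, ‖Df‖ ≤ C sz^k` on `X`, then `‖h‖ ≤ (C⁺ + ‖v‖) sz^k` and
`Dh = Df` (`fderiv_sub_const`). [folklore] -/
theorem growth_of_eq_sub_const {E F : Type*} [NormedAddCommGroup E] [NormedSpace ℝ E]
    [NormedAddCommGroup F] [NormedSpace ℝ F] {X : Set E} (sz : E → ℝ) (hsz : ∀ x ∈ X, 1 ≤ sz x)
    {f h : E → F} (v : F) (hfh : ∀ x, h x = f x - v)
    (hb : ∃ (C : ℝ) (k : ℕ), ∀ x ∈ X, ‖f x‖ ≤ C * sz x ^ k ∧ ‖fderiv ℝ f x‖ ≤ C * sz x ^ k) :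
    ∃ (C : ℝ) (k : ℕ), ∀ x ∈ X, ‖h x‖ ≤ C * sz x ^ k ∧ ‖fderiv ℝ h x‖ ≤ C * sz x ^ k := by
  obtain ⟨C, k, hCk⟩ := hb
  have he : h = fun x => f x - v := funext hfh
  refine ⟨max C 0 + ‖v‖, k, fun x hx => ?_⟩
  obtain ⟨h1, h2⟩ := hCk x hx
  have hsx : 1 ≤ sz x := hsz x hx
  have hs0 : 0 ≤ sz x ^ k := pow_nonneg (zero_le_one.trans hsx) k
  have hs1 : 1 ≤ sz x ^ k := one_le_pow₀ hsx
  have hC : C * sz x ^ k ≤ max C 0 * sz x ^ k := mul_le_mul_of_nonneg_right (le_max_left _ _) hs0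
  constructor
  · rw [hfh x, add_mul]
    exact (norm_sub_le _ _).trans
      (add_le_add (h1.trans hC) (le_mul_of_one_le_right (norm_nonneg v) hs1))
  · rw [he, fderiv_sub_const, add_mul]
    exact (h2.trans hC).trans (le_add_of_nonneg_right (mul_nonneg (norm_nonneg v) hs0))

end FamStairGrowth

/-! ### The registered stub (elaboration context of the skeleton's section `ConeFormAnalytic`)

As in the landed `…HeckeEigenvalueFieldResConeAnalytic.lean` (c8) and the skeleton: calculus of
FORM-valued maps on `hermSpace n K ⊆ M_n(K_∞)` needs ONE topology on the matrices, so the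
product-topology instances are removed for the rest of this file (the topologies agree, definitionally so
at default transparency), and the projection `NormedAddCommGroup → SeminormedAddCommGroup` is tried first
so that the normed structures on `hermSpace n K [⋀^Fin r]→L[ℝ] _` are found along the path of the
`NormedAddCommGroup` instance of `hermSpace`.  Without these three lines the registered header below does
not elaborate (`NormedAddCommGroup (hermSpace n K [⋀^Fin (q+1)]→L[ℝ] E_λ)` is not found). -/

section ConeFormAnalytic

open scoped Matrix.Norms.Operator Topology
open Filter

attribute [-instance] instTopologicalSpaceMatrix
attribute [-instance] Matrix.instUniformSpace
attribute [local instance high] NormedAddCommGroup.toSeminormedAddCommGroup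

/-- **Stub FAM-STAIR-GROWTH — the per-coset staircase has polynomial `C¹` growth on the whole cone**
(same `κ` as FAM-STAIR-ALG, for ANY subgroup `Γc ≤ GL_n(K)⁺` — the arithmetic stabiliser
`Stab(cL).comap diagPos` of the coset being the case of interest; the cone gauge `sz` abstract with the
properties of GAUGE, the growth of `ω_c` given in `sz`).  For `j < q` and for `j = q` in positive form
degree the component of `κ` IS the staircase component, bounded by the landed GROWTH-κ
`stub_stair_growth` (p153484; here `Γ = 𝒢 = Γc`, `L = ⊤`, `X = posCone n K` — open, convex,
`Γc`-stable, containing `x₀ = 1`); in form degree `0` the correction of `κ_q` is a constant `0`-form,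
which adds `‖const‖ sz^k` to the bound of the norm (`sz ≥ 1`) and nothing to the derivative
(`FamStairGrowth.growth_of_eq_sub_const`). [cite: BottTu1982Forms, §I.4] [cite: Borel1983Regularization, §3] -/
theorem stub_fam_stair_growth {n : ℕ} {K : Type} [Field K] [NumberField K]
    (hcpt : isCompact_glFiniteIntegralLevel n K) (𝔫 : Ideal (𝓞 K))
    (π : CuspidalAutomorphicRepData n K hcpt)
    (S : Finset {w : InfinitePlace K // w.IsReal}) (lam : (K →+* ℂ) → Fin n → ℤ) {q : ℕ}
    {η : ConeDictionary.Cochain π.1 lam (q + 1)}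
    (cL : BigHeckeGLn.FiniteAdelicGL n K ⧸ ResGLnCohomology.level n K 𝔫)
    (hωs : ContDiffOn ℝ ((⊤ : ℕ∞) : WithTop ℕ∞)
      (fun H => @id (ResGLnCone.hermSpace n K [⋀^Fin (q + 1)]→L[ℝ] ResGLnCohomology.CoeffModule ℂ n K lam) (ConeDictionary.coneForm π.1 S lam η cL.out H)) (ResGLnCone.posCone n K))
    (Γc : Subgroup (ResGLnCohomology.glTotPos n K))
    (b : (Fin (q + 1) → Γc) → ResGLnCohomology.CoeffModule ℂ n K lam)
    (κ : (j : ℕ) → TwistedQuotient.Coch Γc (⊤ : Subgroup Γc) (ResGLnCone.hermSpace n K) (ResGLnCohomology.CoeffModule ℂ n K lam) j)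
    (hκlt : ∀ j, j < q → κ j = TwistedQuotient.stair (⊤ : Subgroup Γc)
        (((ResGLnCone.coneActionRat n K).comp (ResGLnCohomology.glTotPos n K).subtype).comp Γc.subtype)
        (TwistedQuotient.single (⊤ : Subgroup Γc) (fun (_ : Γc ⧸ (⊤ : Subgroup Γc)) (H : ResGLnCone.hermSpace n K) =>
          @id (ResGLnCone.hermSpace n K [⋀^Fin (q + 1)]→L[ℝ] ResGLnCohomology.CoeffModule ℂ n K lam) (ConeDictionary.coneForm π.1 S lam η cL.out H)))
        (ResGLnCone.hermOne n K) j)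
    (hκq0 : ∀ (g : Fin (q + 1) → Γc) (c : Γc ⧸ (⊤ : Subgroup Γc)) (x : ResGLnCone.hermSpace n K),
      κ q g c 0 x = TwistedQuotient.stair (⊤ : Subgroup Γc)
        (((ResGLnCone.coneActionRat n K).comp (ResGLnCohomology.glTotPos n K).subtype).comp Γc.subtype)
        (TwistedQuotient.single (⊤ : Subgroup Γc) (fun (_ : Γc ⧸ (⊤ : Subgroup Γc)) (H : ResGLnCone.hermSpace n K) =>
          @id (ResGLnCone.hermSpace n K [⋀^Fin (q + 1)]→L[ℝ] ResGLnCohomology.CoeffModule ℂ n K lam) (ConeDictionary.coneForm π.1 S lam η cL.out H)))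
        (ResGLnCone.hermOne n K) q g c 0 x -
        ContinuousAlternatingMap.constOfIsEmpty ℝ (ResGLnCone.hermSpace n K) (Fin 0)
          ((((-1 : ℝ) ^ ((q + 1) * (q + 2) / 2)) : ℂ) • b g))
    (hκqs : ∀ (g : Fin (q + 1) → Γc) (c : Γc ⧸ (⊤ : Subgroup Γc)) (r : ℕ) (x : ResGLnCone.hermSpace n K),
      κ q g c (r + 1) x = TwistedQuotient.stair (⊤ : Subgroup Γc)
        (((ResGLnCone.coneActionRat n K).comp (ResGLnCohomology.glTotPos n K).subtype).comp Γc.subtype)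
        (TwistedQuotient.single (⊤ : Subgroup Γc) (fun (_ : Γc ⧸ (⊤ : Subgroup Γc)) (H : ResGLnCone.hermSpace n K) =>
          @id (ResGLnCone.hermSpace n K [⋀^Fin (q + 1)]→L[ℝ] ResGLnCohomology.CoeffModule ℂ n K lam) (ConeDictionary.coneForm π.1 S lam η cL.out H)))
        (ResGLnCone.hermOne n K) q g c (r + 1) x)
    (sz : ResGLnCone.hermSpace n K → ℝ) (hsz : ∀ x ∈ ResGLnCone.posCone n K, 1 ≤ sz x)
    (hszn : ∃ C₀ : ℝ, ∀ x ∈ ResGLnCone.posCone n K, ‖x‖ ≤ C₀ * sz x)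
    (hseg : ∃ (C : ℝ) (k : ℕ), ∀ x ∈ ResGLnCone.posCone n K, ∀ y ∈ ResGLnCone.posCone n K,
      ∀ t ∈ Set.Icc (0 : ℝ) 1, sz ((1 - t) • x + t • y) ≤ C * (sz x * sz y) ^ k)
    (hωb : ∃ (C : ℝ) (k : ℕ), ∀ x ∈ ResGLnCone.posCone n K,
      ‖@id (ResGLnCone.hermSpace n K [⋀^Fin (q + 1)]→L[ℝ] ResGLnCohomology.CoeffModule ℂ n K lam) (ConeDictionary.coneForm π.1 S lam η cL.out x)‖ ≤ C * sz x ^ k ∧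
      ‖fderiv ℝ (fun H => @id (ResGLnCone.hermSpace n K [⋀^Fin (q + 1)]→L[ℝ] ResGLnCohomology.CoeffModule ℂ n K lam) (ConeDictionary.coneForm π.1 S lam η cL.out H)) x‖ ≤ C * sz x ^ k) :
    ∀ j ≤ q, ∀ (g : Fin (j + 1) → Γc) (c : Γc ⧸ (⊤ : Subgroup Γc)) (r : ℕ),
      ∃ (C : ℝ) (k : ℕ), ∀ x ∈ ResGLnCone.posCone n K,
        ‖κ j g c r x‖ ≤ C * sz x ^ k ∧ ‖fderiv ℝ (κ j g c r) x‖ ≤ C * sz x ^ k := by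
  -- GROWTH-κ for the uncorrected staircase: every level `p`, simplex `g`, coset `c`, degree `r`
  have hG := stub_stair_growth (⊤ : Subgroup Γc)
    (((ResGLnCone.coneActionRat n K).comp (ResGLnCohomology.glTotPos n K).subtype).comp Γc.subtype)
    (ResGLnCone.isOpen_posCone n K) (ResGLnCone.convex_posCone n K)
    (fun γ => ResGLnCone.mapsTo_coneActionRat_posCone n K
      ((γ : ResGLnCohomology.glTotPos n K) : GL (Fin n) K))
    (ResGLnCone.hermOne_mem_posCone n K) sz hsz hszn hseg
    (fun (_ : Γc ⧸ (⊤ : Subgroup Γc)) (H : ResGLnCone.hermSpace n K) =>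
      @id (ResGLnCone.hermSpace n K [⋀^Fin (q + 1)]→L[ℝ] ResGLnCohomology.CoeffModule ℂ n K lam)
        (ConeDictionary.coneForm π.1 S lam η cL.out H))
    (fun _ => hωs) (fun _ => hωb)
  intro j hj g c r
  rcases hj.lt_or_eq with hlt | rfl
  · -- below the top level the tower is the staircase itself
    rw [hκlt j hlt]
    exact hG j g c r
  · cases r with
    | succ r =>
      -- top level, positive form degree: the component is the staircase component (as a function)
      rw [show κ _ g c (r + 1) = _ from funext (hκqs g c r)]
      exact hG _ g c (r + 1)
    | zero =>
      -- top level, form degree `0`: staircase component minus a constant `0`-form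
      exact FamStairGrowth.growth_of_eq_sub_const sz hsz _ (hκq0 g c) (hG _ g c 0)

end ConeFormAnalytic

end Summit.Langlands.Langlands.Theorems.HeckeEigenvalueField.Res

end
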